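import Summits.PneNP.PneNP.Theorems.PermanentDescentCollapseMakesPermanentEasyIslandDefs
import Mathlib.Algebra.Polynomial.BigOperators
import Mathlib.LinearAlgebra.Lagrange
import Mathlib.FieldTheory.Finite.Basic
import HarnessLib

/-!
# Route PermanentDescent, crux `CollapseMakesPermanentEasy` (stmt-PneNP-16142), line `Sketch`
# (idea `errorless-islands`) — `stub_interp`

Registered stub `stub_interp` of the skeleton `Cruxes/CollapseMakesPermanentEasy/Lines/Sketch.lean`, over
the objects of `Theorems/PermanentDescentCollapseMakesPermanentEasyIslandDefs.lean` (namespace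
`Summit.PneNP.PneNP.Theorems.PermIsland`): the two interpolation facts behind the erasure decoding of one
permanent residue on a line through the target.

* (i) `linePoly_exists`: the restriction of the permanent to the line `c ↦ M + c·D` is a polynomial of
  degree `≤ n` — it is the permanent `∑_σ ∏_i` of the matrix of linear polynomials `C (M i j) + X * C (D i j)`;
  every summand is a product of `n` factors of degree `≤ 1`, and evaluation at `c` is a ring map, entry by
  entry the `(σ i, i)` entry of `M + c • D`.
* (ii) `lagrAt0_eq_eval_zero`: the machine-level Lagrange formula `lagrAt0 p pts` (residue arithmetic of
  `CodeFPModArith`) returns `f(0)` from `> deg f` correct values of `f` at distinct nodes `< p` — cast to `𝔽_p`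
  with the `ModArith.natCast_*` meaning lemmas, identify `f` with Mathlib's `Lagrange.interpolate` over the
  finset of the points (`Lagrange.eq_interpolate_of_eval_eq`), and evaluate each Lagrange basis polynomial
  at `0` factor by factor: `(x - y)⁻¹ · (0 - y) = y · (y - x)⁻¹`, the factor at the node itself being `1`.

Sources: S. Arora, B. Barak, *Computational Complexity* (2009), §8.6.2 (Lipton's random self-reduction of
the permanent: the line polynomial), §A.4 (interpolation over a prime field).
-/

set_option linter.dupNamespace false -- `Summit.PneNP.PneNP.…`: summit = sub-problem name (D-0017 single-conjunct layout)

namespace Summit.PneNP.PneNP.Theorems.PermIsland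

open Polynomial Finset
open Literature.Computability.Complexity Literature.Computability.Complexity.ModArith

/-! ### (i) The line polynomial of the permanent -/

/-- **The line restriction of the permanent is a polynomial of degree `≤ n`**: for `n × n` matrices
`M, D` over `ZMod p` there is `f` with `deg f ≤ n` and `f(c) = perm(M + c·D)` for every `c` (the permanent
of the matrix of linear polynomials `M i j + X · D i j`). [cite: AroraBarakCC2009, §8.6.2] -/
theorem linePoly_exists (p n : ℕ) (M D : Matrix (Fin n) (Fin n) (ZMod p)) :
    ∃ f : Polynomial (ZMod p), f.natDegree ≤ n ∧ ∀ c : ZMod p, f.eval c = (M + c • D).permanent := by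
  refine ⟨(Matrix.of fun i j => C (M i j) + X * C (D i j)).permanent, ?_, fun c => ?_⟩
  · unfold Matrix.permanent
    refine natDegree_sum_le_of_forall_le _ _ fun σ _ => ?_
    -- every entry `C a + X * C b` has degree `≤ 1`
    have h1 : ∀ i : Fin n, (Matrix.of (fun i j => C (M i j) + X * C (D i j)) (σ i) i).natDegree ≤ 1 := by
      intro i
      rw [Matrix.of_apply]
      refine (natDegree_add_le _ _).trans (max_le (by rw [natDegree_C]; exact Nat.zero_le _) ?_)
      exact natDegree_mul_le.trans (by rw [natDegree_C, add_zero]; exact natDegree_X_le)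
    refine (natDegree_prod_le _ _).trans ((Finset.sum_le_sum fun i _ => h1 i).trans ?_)
    rw [sum_const, card_univ, Fintype.card_fin, smul_eq_mul, mul_one]
  · unfold Matrix.permanent
    rw [eval_finsetSum]
    refine sum_congr rfl fun σ _ => ?_
    rw [eval_prod]
    refine prod_congr rfl fun i _ => ?_
    rw [Matrix.of_apply, eval_add, eval_mul, eval_C, eval_X, eval_C, Matrix.add_apply, Matrix.smul_apply,
      smul_eq_mul]

/-! ### (ii) `lagrAt0` is Lagrange interpolation at `0` -/

/-- The value at `0` of a Lagrange basis polynomial: `L_i(0) = ∏_{j ≠ i} v_j · (v_j - v_i)⁻¹`. [folklore] -/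
theorem eval_zero_lagrangeBasis {F ι : Type*} [Field F] [DecidableEq ι] (s : Finset ι) (v : ι → F) (i : ι) :
    eval 0 (Lagrange.basis s v i) = ∏ j ∈ s.erase i, v j * (v j - v i)⁻¹ := by
  rw [Lagrange.basis, eval_prod]
  refine prod_congr rfl fun j _ => ?_
  rw [Lagrange.basisDivisor, eval_mul, eval_C, eval_sub, eval_X, eval_C, zero_sub, ← neg_sub (v j) (v i),
    inv_neg]
  ring

/-- A product over `s` whose factor at `a` is `1` is a product over `s ∖ {a}`. [folklore] -/
theorem prod_eq_prod_erase_of_eq_one {ι M : Type*} [DecidableEq ι] [CommMonoid M] {s : Finset ι} {a : ι}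
    (g h : ι → M) (h1 : g a = 1) (h2 : ∀ x ∈ s.erase a, g x = h x) :
    ∏ x ∈ s, g x = ∏ x ∈ s.erase a, h x := by
  rw [← prod_erase s h1]
  exact prod_congr rfl h2

/-- **`lagrAt0` interpolates at `0`** over the prime field `𝔽_p`: if `f` has degree `< |pts|`, the nodes
(first components, naturals `< p`) are distinct and every listed value is `f` at its node, then
`lagrAt0 p pts ≡ f(0) (mod p)`. [cite: AroraBarakCC2009, §A.4] -/
theorem lagrAt0_eq_eval_zero (p : ℕ) [Fact p.Prime] (f : Polynomial (ZMod p)) (pts : List (ℕ × ℕ))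
    (hdeg : f.natDegree < pts.length) (hnd : (pts.map Prod.fst).Nodup)
    (hpts : ∀ q ∈ pts, q.1 < p ∧ (q.2 : ZMod p) = f.eval (q.1 : ZMod p)) :
    (lagrAt0 p pts : ZMod p) = f.eval 0 := by
  classical
  have hnd' : pts.Nodup := hnd.of_map _
  -- distinct listed points have distinct node residues
  have hne : ∀ q ∈ pts, ∀ q' ∈ pts, q ≠ q' → ((q.1 : ℕ) : ZMod p) ≠ ((q'.1 : ℕ) : ZMod p) :=
    fun q hq q' hq' h => natCast_ne_natCast (hpts q hq).1 (hpts q' hq').1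
      fun h1 => h (List.inj_on_of_nodup_map hnd hq hq' h1)
  have hvs : Set.InjOn (fun q : ℕ × ℕ => ((q.1 : ℕ) : ZMod p)) (pts.toFinset : Set (ℕ × ℕ)) := by
    intro q hq q' hq' h
    rw [Finset.mem_coe, List.mem_toFinset] at hq hq'
    by_contra hqq
    exact hne q hq q' hq' hqq h
  have hdeg' : f.degree < (pts.toFinset.card : WithBot ℕ) := by
    rw [List.toFinset_card_of_nodup hnd']
    exact degree_le_natDegree.trans_lt (by exact_mod_cast hdeg)
  have hf : f = Lagrange.interpolate pts.toFinset (fun q : ℕ × ℕ => ((q.1 : ℕ) : ZMod p))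
      fun q : ℕ × ℕ => ((q.2 : ℕ) : ZMod p) :=
    Lagrange.eq_interpolate_of_eval_eq _ hvs hdeg' fun q hq => ((hpts q (List.mem_toFinset.1 hq)).2).symm
  rw [lagrAt0, natCast_sumM, List.map_map, ← List.sum_toFinset _ hnd', hf, Lagrange.interpolate_apply,
    eval_finsetSum]
  refine sum_congr rfl fun q hq => ?_
  have hqm : q ∈ pts := List.mem_toFinset.1 hq
  rw [Function.comp_apply, natCast_mulM, eval_mul, eval_C, eval_zero_lagrangeBasis]
  congr 1
  rw [lagrWeight, natCast_prodM, List.map_map, List.map_map, ← List.prod_toFinset _ hnd']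
  refine prod_eq_prod_erase_of_eq_one _ _ ?_ fun q' hq' => ?_
  · -- the factor at the node itself is `1`
    show (((if q.1 = q.1 then 1 % p else mulM p q.1 (invM p (subM p q.1 q.1)) : ℕ)) : ZMod p) = 1
    rw [if_pos rfl, ZMod.natCast_mod, Nat.cast_one]
  · have hq'q : q' ≠ q := ne_of_mem_erase hq'
    have hq'm : q' ∈ pts := List.mem_toFinset.1 (mem_of_mem_erase hq')
    have hfst : q'.1 ≠ q.1 := fun h => hq'q (List.inj_on_of_nodup_map hnd hq'm hqm h)
    have hsub : ((subM p q'.1 q.1 : ℕ) : ZMod p) ≠ 0 := by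
      rw [natCast_subM]
      exact sub_ne_zero.2 (hne q' hq'm q hqm hq'q)
    show (((if q'.1 = q.1 then 1 % p else mulM p q'.1 (invM p (subM p q'.1 q.1)) : ℕ)) : ZMod p) =
      ((q'.1 : ℕ) : ZMod p) * (((q'.1 : ℕ) : ZMod p) - ((q.1 : ℕ) : ZMod p))⁻¹
    rw [if_neg hfst, natCast_mulM, natCast_invM _ (Or.inl hsub), natCast_subM]

/-! ### The registered stub -/

/-- **Stub `stub_interp`** (line `Sketch`, idea `errorless-islands`): (i) the line restriction
`c ↦ perm(M + c·D)` of the permanent is a polynomial of degree `≤ n`; (ii) `lagrAt0` Lagrange-interpolates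
at `0` over `𝔽_p` from `> deg f` correct values at distinct nodes `< p`. [cite: AroraBarakCC2009, §8.6.2] -/
theorem stub_interp :
    (∀ (p n : ℕ) (M D : Matrix (Fin n) (Fin n) (ZMod p)),
      ∃ f : Polynomial (ZMod p), f.natDegree ≤ n ∧ ∀ c : ZMod p, f.eval c = (M + c • D).permanent) ∧
    (∀ (p : ℕ) [Fact p.Prime] (f : Polynomial (ZMod p)) (pts : List (ℕ × ℕ)),
      f.natDegree < pts.length → (pts.map Prod.fst).Nodup →
      (∀ q ∈ pts, q.1 < p ∧ (q.2 : ZMod p) = f.eval (q.1 : ZMod p)) →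
      (lagrAt0 p pts : ZMod p) = f.eval 0) :=
  ⟨linePoly_exists, fun p _ f pts => lagrAt0_eq_eval_zero p f pts⟩

end Summit.PneNP.PneNP.Theorems.PermIsland
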